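import Mathlib.Analysis.Matrix.Order
import Mathlib.LinearAlgebra.UnitaryGroup
import Literature.MathematicalPhysics.QuantumLattice.SpinSystem
import HarnessLib

/-!
# Product operators `⨂_x u_x` on a finite quantum spin system

Trunk T-QLATTICE; extends `SpinSystem.lean` (same `ℓ²(Λ → Fin q)` picture, decision Q-D1).
The one notion added is the **product operator** `productOp u = ⨂_{x ∈ Λ} u_x` of a family of
single-site matrices `u : Λ → Matrix (Fin q) (Fin q) ℂ`, entrywise
`⟨σ| ⨂ u |τ⟩ = ∏_x (u_x)_{σ_x τ_x}` (Tasaki (2020) §2.2, eq. (2.2.12): the global rotation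
`⨂_x exp(-iθ·𝐒_x)` is the case of a constant family, `globalRotation_eq_productOp`; site-dependent
families are the sublattice rotations of Dyson–Lieb–Simon 1978 §2 / Kennedy–Lieb–Shastry 1988,
and the disorder operators of Kennedy–Tasaki 1992).

Because `⨂` is a `*`-monoid map (`productOp_mul`, `productOp_conjTranspose`, `productOp_one`)
and a single-site operator is the product with all other factors `1` (`onSite_eq_productOp`),
this file also proves the single-site algebra that `SpinSystem.lean` records as named facts:

* `onSite_mul`, `onSite_one'`, `onSite_add'`, `onSite_smul'`, `onSite_mul_onSite_comm` (operators
  at distinct sites commute; Tasaki (2020) eq. (2.2.6); the discharge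
  `siteSpin_commute_of_ne_holds` itself lives in `SpinSystemProofs.lean`);
* `onSite_posSemidef` (`a ≥ 0 ⇒ 𝟙 ⊗ a ⊗ 𝟙 ≥ 0`), `onSite_isHermitian`;
* unitarity `productOp_mul_conjTranspose`, `productOp_mem_unitaryGroup`, and the action on local
  observables `productOp_conj_onSite : (⨂u) (onSite x a) (⨂u)ᴴ = onSite x (u_x a u_xᴴ)`,
  `productOp_conj_siteSpin` (Tasaki (2020) §2.2, eq. (2.2.13): `Û S^α_x Û† = (R S)^α_x`).

## Sources

H. Tasaki, *Physics and Mathematics of Quantum Many-Body Systems* (Springer, 2020), §2.2,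
eqs. (2.2.5), (2.2.6), (2.2.12), (2.2.13); O. Bratteli, D. W. Robinson, *Operator Algebras and
Quantum Statistical Mechanics II*, §6.2.1 (product structure of `𝔄_Λ = ⨂_x M_q(ℂ)`).

## Mathlib / H21 status and design choices

* Mathlib has `Matrix.kroneckerMap` for two factors and `PiTensorProduct` without matrix API;
  an indexed Kronecker product of matrices over `Λ → Fin q` is not available (searched
  `kronecker`, `piTensor`, `PiTensorProduct.toMatrix`: nothing usable). As in `SpinSystem.lean`
  (`onSite`, `localOp`, `globalRotation`) the operator is given by its explicit entry formula;
  multiplicativity is Mathlib's `Finset.prod_univ_sum` (product of sums over `Fintype.piFinset`).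
* Junk-free: all statements hold for every `q` (for `q = 0` the configuration space is empty
  unless `Λ` is, and all operators are `0 × 0` or `1 × 1` matrices).
-/

noncomputable section

open Matrix Complex

namespace Literature.MathematicalPhysics.QuantumLattice

section QLattice

variable {Λ : Type*} [Fintype Λ] [DecidableEq Λ] {q : ℕ}

/-! ### Definition and entries -/

/-- The **product operator** `⨂_{x ∈ Λ} u_x` of a family of single-site matrices, entrywise
`⟨σ| ⨂ u |τ⟩ = ∏_x ⟨σ_x| u_x |τ_x⟩`. Tasaki (2020) §2.2, eq. (2.2.12) (there for the constant
family `u_x = exp(-iθ·𝐒)`). [cite: Tasaki2020, §2.2 eq. (2.2.12)] -/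
def productOp (u : Λ → Matrix (Fin q) (Fin q) ℂ) : Op Λ q :=
  of fun σ τ => ∏ x, u x (σ x) (τ x)

omit [DecidableEq Λ] in
/-- Entries of `productOp u` (definitional unfolding). [folklore] -/
theorem productOp_apply (u : Λ → Matrix (Fin q) (Fin q) ℂ) (σ τ : TensorIndex Λ q) :
    productOp u σ τ = ∏ x, u x (σ x) (τ x) := rfl

omit [DecidableEq Λ] in
/-- The global rotation of `SpinSystem.lean` is the product operator of the constant family of
single-site rotations. Tasaki (2020) §2.2, eq. (2.2.12). [folklore] -/
theorem globalRotation_eq_productOp (n : ℕ) (θ : Fin 3 → ℝ) :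
    globalRotation (Λ := Λ) n θ = productOp fun _ => spinRotation n θ := rfl

/-! ### `⨂` is a `*`-monoid map -/

omit [DecidableEq Λ] in
/-- `⨂_x 1 = 1`. [folklore] -/
@[simp] theorem productOp_one : productOp (fun _ : Λ => (1 : Matrix (Fin q) (Fin q) ℂ)) = 1 := by
  classical
  ext σ τ
  rw [productOp_apply, one_apply]
  by_cases h : σ = τ
  · subst h
    simp
  · rw [if_neg h]
    obtain ⟨x, hx⟩ : ∃ x, σ x ≠ τ x := by
      by_contra hc
      push Not at hc
      exact h (funext hc)
    exact Finset.prod_eq_zero (Finset.mem_univ x) (by simp [one_apply, hx])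

/-- **Multiplicativity** `(⨂ u)(⨂ v) = ⨂ (u v)`: the sum over intermediate configurations
factorises (`Finset.prod_univ_sum`). Bratteli–Robinson II §6.2.1. [folklore] -/
theorem productOp_mul (u v : Λ → Matrix (Fin q) (Fin q) ℂ) :
    productOp u * productOp v = productOp fun x => u x * v x := by
  ext σ τ
  simp only [mul_apply, productOp_apply]
  rw [Finset.prod_univ_sum (fun _ => Finset.univ) fun x j => u x (σ x) j * v x j (τ x),
    Fintype.piFinset_univ]
  refine Finset.sum_congr rfl fun ρ _ => ?_
  rw [← Finset.prod_mul_distrib]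

omit [DecidableEq Λ] in
/-- **`*`-compatibility** `(⨂ u)ᴴ = ⨂ (uᴴ)`. Bratteli–Robinson II §6.2.1. [folklore] -/
theorem productOp_conjTranspose (u : Λ → Matrix (Fin q) (Fin q) ℂ) :
    (productOp u)ᴴ = productOp fun x => (u x)ᴴ := by
  ext σ τ
  simp only [conjTranspose_apply, productOp_apply, star_prod]

/-! ### Single-site operators are product operators -/

/-- **`onSite x a = 𝟙 ⊗ ⋯ ⊗ a ⊗ ⋯ ⊗ 𝟙`** is the product operator of the family that is `a` at
`x` and `1` elsewhere. Tasaki (2020) §2.2, eq. (2.2.5). [folklore] -/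
theorem onSite_eq_productOp (x : Λ) (a : Matrix (Fin q) (Fin q) ℂ) :
    onSite x a = productOp (Function.update (fun _ => (1 : Matrix (Fin q) (Fin q) ℂ)) x a) := by
  ext σ τ
  rw [onSite_apply, productOp_apply, ← Finset.mul_prod_erase Finset.univ _ (Finset.mem_univ x),
    Function.update_self]
  have hrest : ∀ y ∈ Finset.univ.erase x,
      Function.update (fun _ => (1 : Matrix (Fin q) (Fin q) ℂ)) x a y (σ y) (τ y) =
        if σ y = τ y then 1 else 0 := by
    intro y hy
    rw [Function.update_of_ne (Finset.ne_of_mem_erase hy), one_apply]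
  rw [Finset.prod_congr rfl hrest]
  split_ifs with h
  · rw [Finset.prod_eq_one fun y hy => if_pos (h y (Finset.ne_of_mem_erase hy)), mul_one]
  · push Not at h
    obtain ⟨y, hy, hne⟩ := h
    rw [Finset.prod_eq_zero (Finset.mem_erase.mpr ⟨hy, Finset.mem_univ y⟩) (if_neg hne),
      mul_zero]

/-- **`a ↦ onSite x a` is multiplicative**: `(𝟙 ⊗ a ⊗ 𝟙)(𝟙 ⊗ b ⊗ 𝟙) = 𝟙 ⊗ ab ⊗ 𝟙`.
Tasaki (2020) §2.2; Bratteli–Robinson II §6.2.1. [folklore] -/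
theorem onSite_mul (x : Λ) (a b : Matrix (Fin q) (Fin q) ℂ) :
    onSite x a * onSite x b = (onSite x (a * b) : Op Λ q) := by
  rw [onSite_eq_productOp, onSite_eq_productOp, onSite_eq_productOp, productOp_mul]
  congr 1
  funext y
  by_cases hy : y = x
  · subst hy
    simp
  · simp [Function.update_of_ne hy]

/-- `onSite x 1 = 1`. [folklore] -/
@[simp] theorem onSite_one' (x : Λ) : (onSite x (1 : Matrix (Fin q) (Fin q) ℂ) : Op Λ q) = 1 := by
  rw [onSite_eq_productOp, Function.update_eq_self, productOp_one]

/-- `a ↦ onSite x a` is additive. [folklore] -/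
theorem onSite_add' (x : Λ) (a b : Matrix (Fin q) (Fin q) ℂ) :
    (onSite x (a + b) : Op Λ q) = onSite x a + onSite x b := by
  ext σ τ
  simp only [onSite_apply, Matrix.add_apply]
  split_ifs <;> simp

/-- `a ↦ onSite x a` commutes with scalars. [folklore] -/
theorem onSite_smul' (x : Λ) (c : ℂ) (a : Matrix (Fin q) (Fin q) ℂ) :
    (onSite x (c • a) : Op Λ q) = c • onSite x a := by
  ext σ τ
  simp only [onSite_apply, Matrix.smul_apply, smul_eq_mul]
  split_ifs <;> simp

/-- `a ↦ onSite x a` is `ℂ`-linear on differences. [folklore] -/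
theorem onSite_sub' (x : Λ) (a b : Matrix (Fin q) (Fin q) ℂ) :
    (onSite x (a - b) : Op Λ q) = onSite x a - onSite x b := by
  rw [sub_eq_add_neg, onSite_add', ← neg_one_smul ℂ b, onSite_smul', neg_one_smul,
    ← sub_eq_add_neg]

/-- `a ↦ onSite x a` commutes with negation. [folklore] -/
theorem onSite_neg' (x : Λ) (a : Matrix (Fin q) (Fin q) ℂ) :
    (onSite x (-a) : Op Λ q) = -onSite x a := by
  rw [← neg_one_smul ℂ a, onSite_smul', neg_one_smul]

/-- `onSite x a` is Hermitian for Hermitian `a`. [folklore] -/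
theorem onSite_isHermitian (x : Λ) {a : Matrix (Fin q) (Fin q) ℂ} (ha : a.IsHermitian) :
    (onSite x a : Op Λ q).IsHermitian := by
  rw [IsHermitian, ← onSite_conjTranspose, ha.eq]

/-- **Locality for single sites**: operators at distinct sites commute,
`(a ⊗ 𝟙)(𝟙 ⊗ b) = (𝟙 ⊗ b)(a ⊗ 𝟙)`. Tasaki (2020) §2.2, eq. (2.2.6);
Bratteli–Robinson II §6.2.1. [folklore] -/
theorem onSite_mul_onSite_comm {x y : Λ} (hxy : x ≠ y) (a b : Matrix (Fin q) (Fin q) ℂ) :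
    (onSite x a * onSite y b : Op Λ q) = onSite y b * onSite x a := by
  rw [onSite_eq_productOp, onSite_eq_productOp, productOp_mul, productOp_mul]
  congr 1
  funext z
  by_cases hzx : z = x
  · subst hzx
    simp [Function.update_of_ne hxy]
  · by_cases hzy : z = y
    · subst hzy
      simp [Function.update_of_ne hzx]
    · simp [Function.update_of_ne hzx, Function.update_of_ne hzy]

/-- The product of two single-site operators at distinct sites is the product operator of the
family `a` at `x`, `b` at `y`, `1` elsewhere. [folklore] -/
theorem onSite_mul_onSite_eq_productOp {x y : Λ} (hxy : x ≠ y) (a b : Matrix (Fin q) (Fin q) ℂ) :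
    (onSite x a * onSite y b : Op Λ q) =
      productOp (Function.update (Function.update (fun _ => 1) y b) x a) := by
  rw [onSite_eq_productOp, onSite_eq_productOp, productOp_mul]
  congr 1
  funext z
  by_cases hzx : z = x
  · subst hzx
    simp [Function.update_of_ne hxy]
  · by_cases hzy : z = y
    · subst hzy
      simp [Function.update_of_ne hzx]
    · simp [Function.update_of_ne hzx, Function.update_of_ne hzy]

/-! ### Positivity is preserved -/

section Positivity

open scoped ComplexOrder MatrixOrder Matrix.Norms.L2Operator

/-- **`a ≥ 0 ⇒ onSite x a ≥ 0`**: write `a = bᴴ b` (Mathlib's C⋆-order on matrices,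
`CStarAlgebra.nonneg_iff_eq_star_mul_self`); then `onSite x a = (onSite x b)ᴴ (onSite x b)`.
Bratteli–Robinson II §6.2.1 (the embeddings `𝔄_x → 𝔄_Λ` are `*`-homomorphisms, hence
positive). [folklore] -/
theorem onSite_posSemidef (x : Λ) {a : Matrix (Fin q) (Fin q) ℂ} (ha : a.PosSemidef) :
    (onSite x a : Op Λ q).PosSemidef := by
  obtain ⟨b, hb⟩ := CStarAlgebra.nonneg_iff_eq_star_mul_self.mp ha.nonneg
  rw [hb, star_eq_conjTranspose, ← onSite_mul, onSite_conjTranspose]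
  exact posSemidef_conjTranspose_mul_self _

end Positivity

/-! ### Unitarity and the action on local observables -/

/-- `(⨂ u)(⨂ u)ᴴ = 1` if every `u_x u_xᴴ = 1`. Tasaki (2020) §2.2. [folklore] -/
theorem productOp_mul_conjTranspose {u : Λ → Matrix (Fin q) (Fin q) ℂ}
    (hu : ∀ x, u x * (u x)ᴴ = 1) : productOp u * (productOp u)ᴴ = 1 := by
  rw [productOp_conjTranspose, productOp_mul]
  simp only [hu, productOp_one]

/-- `(⨂ u)ᴴ(⨂ u) = 1` if every `u_xᴴ u_x = 1`. Tasaki (2020) §2.2. [folklore] -/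
theorem productOp_conjTranspose_mul {u : Λ → Matrix (Fin q) (Fin q) ℂ}
    (hu : ∀ x, (u x)ᴴ * u x = 1) : (productOp u)ᴴ * productOp u = 1 := by
  rw [productOp_conjTranspose, productOp_mul]
  simp only [hu, productOp_one]

/-- A product of unitaries is unitary. Tasaki (2020) §2.2, eq. (2.2.12). [folklore] -/
theorem productOp_mem_unitaryGroup {u : Λ → Matrix (Fin q) (Fin q) ℂ}
    (hu : ∀ x, u x ∈ Matrix.unitaryGroup (Fin q) ℂ) :
    productOp u ∈ Matrix.unitaryGroup (TensorIndex Λ q) ℂ := by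
  rw [Matrix.mem_unitaryGroup_iff]
  exact productOp_mul_conjTranspose fun x => Matrix.mem_unitaryGroup_iff.mp (hu x)

/-- **Product unitaries act locally**: `(⨂ u) (onSite x a) (⨂ u)ᴴ = onSite x (u_x a u_xᴴ)`
when all `u_y u_yᴴ = 1`. Tasaki (2020) §2.2, eq. (2.2.13). [folklore] -/
theorem productOp_conj_onSite {u : Λ → Matrix (Fin q) (Fin q) ℂ} (hu : ∀ y, u y * (u y)ᴴ = 1)
    (x : Λ) (a : Matrix (Fin q) (Fin q) ℂ) :
    productOp u * onSite x a * (productOp u)ᴴ = (onSite x (u x * a * (u x)ᴴ) : Op Λ q) := by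
  rw [onSite_eq_productOp, onSite_eq_productOp, productOp_conjTranspose, productOp_mul,
    productOp_mul]
  congr 1
  funext y
  by_cases hy : y = x
  · subst hy
    simp
  · simp [Function.update_of_ne hy, hu y]

/-- **Rotated spins**: `(⨂ u) S^α_x (⨂ u)ᴴ = onSite x (u_x S^α u_xᴴ)`.
Tasaki (2020) §2.2, eq. (2.2.13). [folklore] -/
theorem productOp_conj_siteSpin {n : ℕ} {u : Λ → Matrix (Fin (n + 1)) (Fin (n + 1)) ℂ}
    (hu : ∀ y, u y * (u y)ᴴ = 1) (x : Λ) (α : Fin 3) :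
    productOp u * siteSpin n x α * (productOp u)ᴴ =
      (onSite x (u x * spinVec n α * (u x)ᴴ) : Op Λ (n + 1)) :=
  productOp_conj_onSite hu x (spinVec n α)

/-- Conjugation by a product unitary is multiplicative on observables:
`U (A B) Uᴴ = (U A Uᴴ)(U B Uᴴ)` when `Uᴴ U = 1`. [folklore] -/
theorem productOp_conj_mul {u : Λ → Matrix (Fin q) (Fin q) ℂ} (hu : ∀ y, (u y)ᴴ * u y = 1)
    (A B : Op Λ q) :
    productOp u * (A * B) * (productOp u)ᴴ =
      (productOp u * A * (productOp u)ᴴ) * (productOp u * B * (productOp u)ᴴ) := by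
  have h := productOp_conjTranspose_mul hu
  simp only [mul_assoc]
  rw [← mul_assoc (productOp u)ᴴ (productOp u), h, one_mul]

end QLattice

end Literature.MathematicalPhysics.QuantumLattice
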